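import Literature.NumberTheory.LFunctions.Zhang2022.TypedSection10A
import Literature.NumberTheory.LFunctions.Zhang2022.TypedSection10B

/-!
# Zhang (2022) §10, the Remark on p. 56 (Z22:§10.u031) follows from (10.6) by substitution

Topic `Literature/NumberTheory/LFunctions/Zhang2022` (Landau–Siegel audit tree; verdict-neutral).
Y. Zhang, arXiv:2211.02515v1 [Zhang2022LandauSiegel], §10 p. 56, Remark after Lemma 10.2:
"Similar to (10.6), `f̃(log y/log P + 0.004 − α̃) = (500/log P)·(1/2πi)∫_{(1)} (Dt₀/P^{0.004})^s
((P₁′)^s − 2(P₂′)^s + (P₃′)^s) y^{−s} ds/s²`." Kernel EDGE: the typed Remark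
(`Typed.Sec10B.RemarkMellinShift`, node Z22:§10.u031, file `TypedSection10B`) follows from (10.6)
(`Typed.Sec10A.Eq106`, node Z22:(10.6), file `TypedSection10A`) by the substitution
`y ↦ y* = yP^{0.004}/(Dt₀)` (`Typed.Sec10B.yShift`), because `log y*/log P = log y/log P + 0.004 − α̃`
(`α̃ = log(Dt₀)/log P`, (2.30)) and `(y*)^{−s} = (Dt₀/P^{0.004})^s y^{−s}`. Two forms: from (10.6) as
banked (with the blanket hypothesis (A)) to the (A)-guarded Remark, and from the bare identity (10.6)
to the bare Remark. Theorems only; nothing here asserts (10.6) itself.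
-/

noncomputable section

open Complex Real
open Literature.NumberTheory.LFunctions.Zhang2022.Skeleton
open Literature.NumberTheory.LFunctions.Zhang2022.Typed

namespace Literature.NumberTheory.LFunctions.Zhang2022.Typed.Sec10B

/-- `log y/log P + 0.004 − α̃ = log y*/log P`, `y* = yP^{0.004}/(Dt₀)` (`y > 0`, `D ≥ 2`).
[cite: Zhang2022LandauSiegel, §10 p. 56] -/
theorem shiftArg_eq {D : ℕ} (hD : 2 ≤ D) {y : ℝ} (hy : 0 < y) :
    Real.log y / Real.log (bigP D) + 0.004 - alphaTilde D =
      Real.log (yShift D y) / Real.log (bigP D) := by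
  have hD1 : (1 : ℝ) < D := by exact_mod_cast hD
  have hP : 0 < bigP D := Real.exp_pos _
  have hlogP : Real.log (bigP D) ≠ 0 := by
    rw [bigP, Real.log_exp]; exact (pow_pos (Real.log_pos hD1) _).ne'
  have ht0 : 0 < t0 D := by rw [t0]; exact pow_pos (Real.log_pos hD1) _
  have hDt : 0 < (D : ℝ) * t0 D := by positivity
  have hpow : 0 < bigP D ^ (0.004 : ℝ) := Real.rpow_pos_of_pos hP _
  rw [yShift, alphaTilde, Real.log_div (by positivity) hDt.ne', Real.log_mul hy.ne' hpow.ne',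
    Real.log_rpow hP]
  field_simp

/-- `0 < y*` for `y > 0`, `D ≥ 2`. [cite: Zhang2022LandauSiegel, §10 p. 56] -/
theorem yShift_pos {D : ℕ} (hD : 2 ≤ D) {y : ℝ} (hy : 0 < y) : 0 < yShift D y := by
  have hD1 : (1 : ℝ) < D := by exact_mod_cast hD
  have ht0 : 0 < t0 D := by rw [t0]; exact pow_pos (Real.log_pos hD1) _
  rw [yShift]
  exact div_pos (mul_pos hy (Real.rpow_pos_of_pos (Real.exp_pos _) _)) (by positivity)

/-- The kernels agree: `((P₁′)^s − 2(P₂′)^s + (P₃′)^s)(y*)^{−s}s^{−2} = (Dt₀/P^{0.004})^s(…)y^{−s}s^{−2}`.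
[cite: Zhang2022LandauSiegel, §10 p. 56] -/
theorem kernelShift_eq {D : ℕ} (hD : 2 ≤ D) {y : ℝ} (hy : 0 < y) (s : ℂ) :
    ((Sec10A.Pp1 D : ℂ) ^ s - 2 * (Sec10A.Pp2 D : ℂ) ^ s + (Sec10A.Pp3 D : ℂ) ^ s) /
        (yShift D y : ℂ) ^ s / s ^ 2 = mellinKernelShift D y s := by
  have hD1 : (1 : ℝ) < D := by exact_mod_cast hD
  have hP : 0 < bigP D := Real.exp_pos _
  have ht0 : 0 < t0 D := by rw [t0]; exact pow_pos (Real.log_pos hD1) _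
  have hDt : 0 < (D : ℝ) * t0 D := by positivity
  have hpow : 0 < bigP D ^ (0.004 : ℝ) := Real.rpow_pos_of_pos hP _
  set c : ℝ := (D : ℝ) * t0 D / bigP D ^ (0.004 : ℝ) with hc
  have hcpos : 0 < c := div_pos hDt hpow
  have hys : yShift D y = y * c⁻¹ := by rw [yShift, hc, inv_div]; ring
  have h1 : ((yShift D y : ℝ) : ℂ) ^ s = (y : ℂ) ^ s * ((c : ℂ) ^ s)⁻¹ := by
    rw [hys, Complex.ofReal_mul, Complex.mul_cpow_ofReal_nonneg hy.le (inv_nonneg.mpr hcpos.le),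
      Complex.ofReal_inv, Complex.inv_cpow _ _ (by
        rw [Complex.arg_ofReal_of_nonneg hcpos.le]; exact Real.pi_ne_zero.symm)]
  have hy0 : (y : ℂ) ^ s ≠ 0 := by
    rw [Ne, Complex.cpow_eq_zero_iff, not_and_or]; left; exact_mod_cast hy.ne'
  have hc0 : (c : ℂ) ^ s ≠ 0 := by
    rw [Ne, Complex.cpow_eq_zero_iff, not_and_or]; left; exact_mod_cast hcpos.ne'
  rw [mellinKernelShift, h1]
  simp only [Sec10A.Pp1, Sec10A.Pp2, Sec10A.Pp3, ← hc]
  field_simp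

/-- **EDGE (PROVED): Z22:(10.6) ⟹ Z22:§10.u031 under the blanket (A)**: from t1's typed
`Typed.Sec10A.Eq106` (which carries (A) as a standing hypothesis) to the (A)-guarded form of the
Remark's Mellin formula for the shifted `f̃`. [cite: Zhang2022LandauSiegel, §10 p. 56] -/
theorem remarkMellinShiftA_of_eq106 (h : Sec10A.Eq106) :
    ForAllLarge fun D _ χ => AssumptionA D χ → ∀ y : ℝ, 0 < y →
      ((ftilde (Real.log y / Real.log (bigP D) + 0.004 - alphaTilde D) : ℝ) : ℂ) =
        500 / (Real.log (bigP D) : ℂ) * (1 / (2 * π) : ℂ) *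
          ∫ t : ℝ, mellinKernelShift D y (1 + t * I) := by
  obtain ⟨D₀, H⟩ := h
  refine ⟨max D₀ 2, fun D _ χ hD hq hp hA y hy => ?_⟩
  have hD₀ : D₀ ≤ D := le_trans (le_max_left _ _) hD
  have hD2 : 2 ≤ D := le_trans (le_max_right _ _) hD
  have key := H D χ hD₀ hq hp hA (yShift D y) (yShift_pos hD2 hy)
  rw [shiftArg_eq hD2 hy, key, Sec10A.lineInt, mul_assoc]
  congr 2
  refine MeasureTheory.integral_congr_ae (Filter.Eventually.of_forall fun t => ?_)
  simp only [Complex.ofReal_one]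
  exact kernelShift_eq hD2 hy _

/-- **EDGE (PROVED): the bare identity (10.6) ⟹ `Typed.Sec10B.RemarkMellinShift`** (Z22:§10.u031 as
typed, without (A)): the hypothesis is (10.6) for `y > 0` and all large `D`, stated over t1's
`Sec10A.lineInt`, `Pp1`, `Pp2`, `Pp3`. [cite: Zhang2022LandauSiegel, §10 p. 56] -/
theorem remarkMellinShift_of_eq106 (h : ForAllLarge fun D _ _ => ∀ y : ℝ, 0 < y →
      (ftilde (Real.log y / Real.log (bigP D)) : ℂ) =
        (500 : ℂ) / (Real.log (bigP D) : ℂ) *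
          Sec10A.lineInt 1 (fun s => ((Sec10A.Pp1 D : ℂ) ^ s - 2 * (Sec10A.Pp2 D : ℂ) ^ s +
            (Sec10A.Pp3 D : ℂ) ^ s) / (y : ℂ) ^ s / s ^ 2)) :
    RemarkMellinShift := by
  obtain ⟨D₀, H⟩ := h
  refine ⟨max D₀ 2, fun D _ χ hD hq hp y hy => ?_⟩
  have hD₀ : D₀ ≤ D := le_trans (le_max_left _ _) hD
  have hD2 : 2 ≤ D := le_trans (le_max_right _ _) hD
  have key := H D χ hD₀ hq hp (yShift D y) (yShift_pos hD2 hy)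
  rw [shiftArg_eq hD2 hy, key, Sec10A.lineInt, mul_assoc]
  congr 2
  refine MeasureTheory.integral_congr_ae (Filter.Eventually.of_forall fun t => ?_)
  simp only [Complex.ofReal_one]
  exact kernelShift_eq hD2 hy _

/-- The inverse substitution: `yShift D (y·Dt₀/P^{0.004}) = y` (`D ≥ 2`).
[cite: Zhang2022LandauSiegel, §10 p. 56] -/
theorem yShift_unshift {D : ℕ} (hD : 2 ≤ D) (y : ℝ) :
    yShift D (y * ((D : ℝ) * t0 D / bigP D ^ (0.004 : ℝ))) = y := by
  have hD1 : (1 : ℝ) < D := by exact_mod_cast hD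
  have ht0 : 0 < t0 D := by rw [t0]; exact pow_pos (Real.log_pos hD1) _
  have hDt : (D : ℝ) * t0 D ≠ 0 := by positivity
  have hpow : bigP D ^ (0.004 : ℝ) ≠ 0 := (Real.rpow_pos_of_pos (Real.exp_pos _) _).ne'
  rw [yShift]
  field_simp

/-- **EDGE (PROVED), converse direction: `Typed.Sec10B.RemarkMellinShift` ⟹ the bare identity (10.6)**
(substitute `y ↦ y·Dt₀/P^{0.004}`), so the Remark (Z22:§10.u031) and (10.6) (Z22:(10.6), without the
blanket (A)) are equivalent as typed. [cite: Zhang2022LandauSiegel, §10 p. 56] -/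
theorem eq106_of_remarkMellinShift (h : RemarkMellinShift) :
    ForAllLarge fun D _ _ => ∀ y : ℝ, 0 < y →
      (ftilde (Real.log y / Real.log (bigP D)) : ℂ) =
        (500 : ℂ) / (Real.log (bigP D) : ℂ) *
          Sec10A.lineInt 1 (fun s => ((Sec10A.Pp1 D : ℂ) ^ s - 2 * (Sec10A.Pp2 D : ℂ) ^ s +
            (Sec10A.Pp3 D : ℂ) ^ s) / (y : ℂ) ^ s / s ^ 2) := by
  obtain ⟨D₀, H⟩ := h
  refine ⟨max D₀ 2, fun D _ χ hD hq hp y hy => ?_⟩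
  have hD₀ : D₀ ≤ D := le_trans (le_max_left _ _) hD
  have hD2 : 2 ≤ D := le_trans (le_max_right _ _) hD
  have hD1 : (1 : ℝ) < D := by exact_mod_cast hD2
  have ht0 : 0 < t0 D := by rw [t0]; exact pow_pos (Real.log_pos hD1) _
  have hc : 0 < (D : ℝ) * t0 D / bigP D ^ (0.004 : ℝ) :=
    div_pos (by positivity) (Real.rpow_pos_of_pos (Real.exp_pos _) _)
  set y' : ℝ := y * ((D : ℝ) * t0 D / bigP D ^ (0.004 : ℝ)) with hy'
  have hy'pos : 0 < y' := mul_pos hy hc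
  have hshift : yShift D y' = y := yShift_unshift hD2 y
  have key := H D χ hD₀ hq hp y' hy'pos
  -- rewrite the Remark at `y'` through `yShift D y' = y`
  rw [shiftArg_eq hD2 hy'pos, hshift] at key
  rw [key, Sec10A.lineInt, mul_assoc]
  congr 2
  refine MeasureTheory.integral_congr_ae (Filter.Eventually.of_forall fun t => ?_)
  simp only [Complex.ofReal_one]
  rw [← kernelShift_eq hD2 hy'pos, hshift]

end Literature.NumberTheory.LFunctions.Zhang2022.Typed.Sec10B
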